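import Literature.NumberTheory.CubicFields.ShintaniDualDensity
import Literature.NumberTheory.CubicFields.FundCubicFieldCountLandauInput
import Literature.NumberTheory.LFunctions.MoebiusCoprimeSum
import HarnessLib

/-!
# BTT (3) from Theorem 2.4, Theorem 3.2, Proposition 5.1 and Proposition 4.5, stated on the real objects

Topic `Literature/NumberTheory/CubicFields`; the last glue file of the direct proof (§5) of
Bhargava–Taniguchi–Thorne 2023, display (3) = `btt_fundCubicFieldCount_sum`:

  `N^±_{3,fund}(X) = (C^∓ … ) = 3/(2π²) X` resp. `1/(2π²) X + K X^{5/6} + O_ε(X^{2/3+ε})`.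

`FundCubicFieldCountLandauInput.lean` proved (3) from the hypothesis structure `ShintaniFamilyInput s A` (abstract
data `r₁, r₂, δ̂₁` subject to the residue bounds, (21), Prop. 5.1 and Thm 3.2) and `btt_uniformity_sqDvd`
(Prop. 4.5). Here the data are the REAL OBJECTS — the residues `Res_{s=1}, Res_{s=5/6}` of the analytic continuation
of `ξ^±(s, Ψ_{q²})` (`ShintaniZetaResidues.lean`) and the dual density `δ̂₁(Ψ_{q²})` built from the Fourier
transform on `V(ℤ/mℤ)` and Shintani's `ι` (`ShintaniDualDensity.lean`) — and the hypotheses are exactly the three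
theorems of the source that Mathlib lacks, each in its printed form:

* `h24 : ∀ q squarefree, ∀ sgn = ±1, HasPsiResidues q sgn` — **Theorem 2.4** with (13), (14), (eq:res_p2)
  (Shintani; Datskovsky–Wright; Taniguchi–Thorne, *Orbital L-functions*, Prop. 8.6, Cor. 8.15);
* `h32 : ∀ c₁₆ c₁₉ c_L c_U > 0, ∃ C, LandauAverageBound c₁₆ c₁₉ c_L c_U C` — **Theorem 3.2** ([LDTT]);
* `h51 : ∀ ε > 0, ∃ C, DualDensityPsiBound ε C` — **Proposition 5.1**;
* `hU : btt_uniformity_sqDvd` — **Proposition 4.5** (the tree's existing named fact).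

PROVED here:
* `hasProd_one_sub_inv_sq` — `∏_p (1 − p⁻²) = 6/π²`; `hasSum_moebius_mul_resFactor1` — **(21) for `M = 1`**:
  `Σ_q μ(q) ∏_{p∣q}(2p⁻² − p⁻⁴) = ∏_p (1 − 2p⁻² + p⁻⁴) = (6/π²)²` (Euler product of a multiplicative function,
  Mathlib's `EulerProduct.eulerProduct_hasProd`), whence the main constants
  `(α⁻ + β)(6/π²)² = (π²/12)(36/π⁴) = 3/π²` and `(α⁺ + β)(6/π²)² = (π²/18)(36/π⁴) = 2/π²` (`mainConstant_neg_one/one`);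
* `shintaniFamilyInput_of` — `h24, h32, h51 ⟹ ShintaniFamilyInput s ((α^s + β)(6/π²)²)` (`r₁(q) = (α^s+β)∏(2p⁻²−p⁻⁴)`,
  `r₂(q) = (6/5)γ^s ∏ 𝒞_p`, `δ̂₁(q) = dualDensity (psiMod q)`; the bounds `r₁ ≍ q⁻²…q^{-2+η}`, `r₂ ≪ q^{-5/3+η}` from
  `2^{ω(q)}, 4^{ω(q)} ≪_η q^η`; (16) ⟹ Thm 3.2's hypothesis since `‖Res_{5/6}‖ = (5/6)|r₂|`; `N^s(X, Ψ_{q²}) = nonFundCount`);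
* `btt_fundCubicFieldCount_sum_of_thm24_thm32_prop51` — **(3)** from `h24, h32, h51, hU`; and
  `btt_threeTorsion_sum_of_thm24_thm32_prop51` — Theorem 1.2 with the class-field-theory dictionary.

## References

* M. Bhargava, T. Taniguchi, F. Thorne, *Improved error estimates for the Davenport–Heilbronn theorems*,
  Math. Ann. 389 (2024) = arXiv:2107.12819, Thm 2.4, Thm 3.2, Prop. 4.5, Prop. 5.1, §5 (20)–(21), (eq:main_term)
  [BhargavaTaniguchiThorne2023].
* D. Lowry-Duda, T. Taniguchi, F. Thorne, *Uniform bounds for lattice point counting and partial sums of zeta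
  functions*, Math. Z. 300 (2022) = arXiv:1710.02190 [LowrydudaTaniguchiThorne2017].
-/

noncomputable section

open Finset Real ArithmeticFunction Filter Topology
open scoped ArithmeticFunction.Moebius

namespace Literature.NumberTheory.CubicFields

open Literature.NumberTheory.LFunctions

/-! ### The Euler product `Σ_q μ(q) ∏_{p∣q} (2p⁻² − p⁻⁴) = (6/π²)²` ((21), `M = 1`) -/

/-- **`∏_p (1 − p⁻²) = 6/π²`** (`= 1/ζ(2)`; from the tree's `Σ μ(d)/d² = 6/π²` and its Euler product). [folklore] -/
theorem hasProd_one_sub_inv_sq : HasProd (fun p : Nat.Primes => 1 - ((p : ℝ) ^ 2)⁻¹) (6 / Real.pi ^ 2) := by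
  have h := hasProd_moebCop 1
  rw [tsum_moebCop_one] at h
  refine h.congr_fun fun p => ?_
  have hp : ¬ (p : ℕ) ∣ 1 := fun hd => p.2.one_lt.ne' (Nat.dvd_one.mp hd)
  simp [hp]

/-- `2p⁻² − p⁻⁴ = 1 − (1 − p⁻²)²` in the `rpow` spelling of `resFactor1`. [folklore] -/
theorem factor1_eq {p : ℕ} (hp : p.Prime) :
    2 * (p : ℝ) ^ (-2 : ℝ) - (p : ℝ) ^ (-4 : ℝ) = 1 - (1 - ((p : ℝ) ^ 2)⁻¹) ^ 2 := by
  have hp0 : (0 : ℝ) < p := by exact_mod_cast hp.pos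
  have h2 : (p : ℝ) ^ (-2 : ℝ) = ((p : ℝ) ^ 2)⁻¹ := by
    rw [Real.rpow_neg hp0.le, show (2 : ℝ) = (2 : ℕ) by norm_num, Real.rpow_natCast]
  have h4 : (p : ℝ) ^ (-4 : ℝ) = ((p : ℝ) ^ 2)⁻¹ ^ 2 := by
    rw [Real.rpow_neg hp0.le, show (4 : ℝ) = (4 : ℕ) by norm_num, Real.rpow_natCast, ← inv_pow]; ring
  rw [h2, h4]; ring

/-- `μ(q) ∏_{p ∣ q}(2p⁻² − p⁻⁴)` is bounded by `C q^{-3/2}` (it vanishes unless `q` is squarefree, and then it is at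
most `2^{ω(q)} q⁻² ≤ C q^{1/2} q⁻²`). [folklore] -/
theorem exists_abs_moebius_mul_resFactor1_le :
    ∃ C : ℝ, 0 < C ∧ ∀ q : ℕ, q ≠ 0 → |(μ q : ℝ) * resFactor1 q| ≤ C * (q : ℝ) ^ (-(3 : ℝ) / 2) := by
  obtain ⟨C, hC, hωC⟩ := pow_card_primeFactors_le (A := 2) (by norm_num) (ε := 1 / 2) (by norm_num)
  refine ⟨C, hC, fun q hq => ?_⟩
  have hq0 : (0 : ℝ) < q := by exact_mod_cast Nat.pos_of_ne_zero hq
  by_cases hsq : Squarefree q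
  · rw [abs_mul]
    have hμ : |(μ q : ℝ)| ≤ 1 := by exact_mod_cast ArithmeticFunction.abs_moebius_le_one
    have hres : |resFactor1 q| ≤ (2 : ℝ) ^ q.primeFactors.card * (q : ℝ) ^ (-2 : ℝ) := by
      rw [abs_of_pos (resFactor1_pos q)]; exact resFactor1_le hsq
    calc |(μ q : ℝ)| * |resFactor1 q| ≤ 1 * ((2 : ℝ) ^ q.primeFactors.card * (q : ℝ) ^ (-2 : ℝ)) :=
          mul_le_mul hμ hres (abs_nonneg _) zero_le_one
      _ ≤ C * (q : ℝ) ^ ((1 : ℝ) / 2) * (q : ℝ) ^ (-2 : ℝ) := by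
          rw [one_mul]
          exact mul_le_mul_of_nonneg_right (hωC q hq) (Real.rpow_nonneg hq0.le _)
      _ = C * (q : ℝ) ^ (-(3 : ℝ) / 2) := by
          rw [mul_assoc, ← Real.rpow_add hq0]; norm_num
  · rw [ArithmeticFunction.moebius_eq_zero_of_not_squarefree hsq]
    simp only [Int.cast_zero, zero_mul, abs_zero]
    positivity

/-- `∏_{p ∣ mn} = ∏_{p ∣ m} · ∏_{p ∣ n}` for coprime `m, n`: `resFactor1` is multiplicative. [folklore] -/
theorem resFactor1_mul_of_coprime {m n : ℕ} (hm : m ≠ 0) (hn : n ≠ 0) (hmn : m.Coprime n) :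
    resFactor1 (m * n) = resFactor1 m * resFactor1 n := by
  unfold resFactor1
  rw [Nat.primeFactors_mul hm hn, Finset.prod_union hmn.disjoint_primeFactors]

/-- At a prime: `resFactor1 p = 2p⁻² − p⁻⁴`. [folklore] -/
theorem resFactor1_prime {p : ℕ} (hp : p.Prime) :
    resFactor1 p = 2 * (p : ℝ) ^ (-2 : ℝ) - (p : ℝ) ^ (-4 : ℝ) := by
  rw [resFactor1, hp.primeFactors, Finset.prod_singleton]

/-- **(21) for `M = 1`: `Σ_q μ(q) ∏_{p ∣ q}(2p⁻² − p⁻⁴) = ∏_p (1 − p⁻²)² = (6/π²)²`** — "The products are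
evaluated using the formulas in (eq:res_p2)": the Euler product of the multiplicative function
`q ↦ μ(q)𝒜(Ψ_{q²})`, local factor `1 − 𝒜(Φ'_p) = (1 − p⁻²)²` at `p`.
[cite: BhargavaTaniguchiThorne2023, §5 (eq:main_term) with (21) (∏_p (1 − 𝒜(Ψ_{p²})), ∏_p (1 − ℬ(Ψ_{p²})))] -/
theorem hasSum_moebius_mul_resFactor1 :
    HasSum (fun q : ℕ => (μ q : ℝ) * resFactor1 q) ((6 / Real.pi ^ 2) ^ 2) := by
  set f : ℕ → ℝ := fun q => (μ q : ℝ) * resFactor1 q with hf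
  have hf1 : f 1 = 1 := by simp [hf, resFactor1_one]
  have hf0 : f 0 = 0 := by simp [hf]
  have hmul : ∀ {m n : ℕ}, m.Coprime n → f (m * n) = f m * f n := by
    intro m n hmn
    rcases eq_or_ne m 0 with rfl | hm
    · simp [hf]
    rcases eq_or_ne n 0 with rfl | hn
    · simp [hf]
    simp only [hf]
    rw [ArithmeticFunction.isMultiplicative_moebius.map_mul_of_coprime hmn, resFactor1_mul_of_coprime hm hn hmn]
    push_cast; ring
  -- summability by comparison with `C q^{-3/2}`
  obtain ⟨C, -, hCle⟩ := exists_abs_moebius_mul_resFactor1_le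
  have hsum : Summable fun n => ‖f n‖ := by
    refine Summable.of_nonneg_of_le (fun _ => norm_nonneg _) (fun n => ?_)
      (((Real.summable_nat_rpow.mpr (by norm_num : (-(3 : ℝ) / 2) < -1)).mul_left C).congr
        (fun n => rfl))
    rcases eq_or_ne n 0 with rfl | hn
    · simp [hf0]
    · rw [Real.norm_eq_abs]; exact hCle n hn
  have hEP := EulerProduct.eulerProduct_hasProd hf1 hmul hsum hf0
  -- the local factors: `Σ_e f(p^e) = 1 + f(p) = 1 − (2p⁻² − p⁻⁴) = (1 − p⁻²)²`
  have hloc : ∀ p : Nat.Primes, ∑' e, f ((p : ℕ) ^ e) = (1 - (((p : ℕ) : ℝ) ^ 2)⁻¹) * (1 - (((p : ℕ) : ℝ) ^ 2)⁻¹) := by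
    intro p
    have hp : (p : ℕ).Prime := p.2
    have hsupp : ∀ e ∉ ({0, 1} : Finset ℕ), f ((p : ℕ) ^ e) = 0 := by
      intro e he
      simp only [Finset.mem_insert, Finset.mem_singleton, not_or] at he
      simp only [hf, ArithmeticFunction.moebius_apply_prime_pow hp he.1, if_neg he.2, Int.cast_zero, zero_mul]
    rw [tsum_eq_sum hsupp, Finset.sum_pair zero_ne_one, pow_zero, pow_one, hf1]
    simp only [hf, ArithmeticFunction.moebius_apply_prime hp, resFactor1_prime hp, factor1_eq hp]
    push_cast; ring
  have hEP' : HasProd (fun p : Nat.Primes => (1 - (((p : ℕ) : ℝ) ^ 2)⁻¹) * (1 - (((p : ℕ) : ℝ) ^ 2)⁻¹)) (∑' n, f n) :=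
    hEP.congr_fun fun p => (hloc p).symm
  have hζ := hasProd_one_sub_inv_sq.mul hasProd_one_sub_inv_sq
  have hval : ∑' n, f n = 6 / Real.pi ^ 2 * (6 / Real.pi ^ 2) := hEP'.unique hζ
  rw [sq, ← hval]
  exact hsum.of_norm.hasSum

/-- **The main constant `(α^s + β) ∏_p (1 − 2p⁻² + p⁻⁴) = (α^s + β)(6/π²)²`** of the sieved first residues
(`= 3/π²` for `s = −1`, `2/π²` for `s = 1`). [cite: BhargavaTaniguchiThorne2023, §5 (eq:main_term) (the X-coefficient of N_{≤3}^± for Σ_p = A'_p)] -/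
def mainConstant (s : ℤ) : ℝ :=
  (shintaniAlpha s + shintaniBeta) * (6 / Real.pi ^ 2) ^ 2

/-- `(α⁻ + β)(6/π²)² = (π²/12)(36/π⁴) = 3/π²`. [folklore] -/
theorem mainConstant_neg_one : mainConstant (-1) = 3 / Real.pi ^ 2 := by
  rw [mainConstant, shintaniAlpha_neg_one_add_beta]
  have hπ : Real.pi ≠ 0 := Real.pi_ne_zero
  field_simp
  ring

/-- `(α⁺ + β)(6/π²)² = (π²/18)(36/π⁴) = 2/π²`. [folklore] -/
theorem mainConstant_one : mainConstant 1 = 2 / Real.pi ^ 2 := by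
  rw [mainConstant, shintaniAlpha_one_add_beta]
  have hπ : Real.pi ≠ 0 := Real.pi_ne_zero
  field_simp
  ring

/-- `Σ_q μ(q) (α^s + β) ∏_{p∣q}(2p⁻² − p⁻⁴) = mainConstant s`. [folklore] -/
theorem hasSum_moebius_mul_r₁ (s : ℤ) :
    HasSum (fun q : ℕ => ((μ q : ℤ) : ℝ) * ((shintaniAlpha s + shintaniBeta) * resFactor1 q)) (mainConstant s) := by
  have h := hasSum_moebius_mul_resFactor1.mul_left (shintaniAlpha s + shintaniBeta)
  rw [mainConstant]
  refine h.congr_fun fun q => ?_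
  ring

/-! ### `2^{ω(q)}, 4^{ω(q)} ≪_η q^η`: the residue bounds `r₁ ≪ q^{-2+η}`, `r₂ ≪ q^{-5/3+η}` -/

/-- `(α^s + β)∏_{p∣q}(2p⁻² − p⁻⁴) ≤ C_η q^{-2+η}` on squarefree `q` ((13) + (15) + (eq:res_p2)). [folklore] -/
theorem exists_r₁_le (s : ℤ) {η : ℝ} (hη : 0 < η) : ∃ C₁ : ℝ, ∀ q : ℕ, Squarefree q →
    |(shintaniAlpha s + shintaniBeta) * resFactor1 q| ≤ C₁ * (q : ℝ) ^ (-2 + η) := by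
  obtain ⟨C, hC, hωC⟩ := pow_card_primeFactors_le (A := 2) (by norm_num) hη
  refine ⟨(shintaniAlpha s + shintaniBeta) * C, fun q hq => ?_⟩
  have hq0 : (0 : ℝ) < q := by exact_mod_cast Nat.pos_of_ne_zero hq.ne_zero
  have hab : 0 < shintaniAlpha s + shintaniBeta := add_pos (shintaniAlpha_pos s) shintaniBeta_pos
  rw [abs_of_pos (mul_pos hab (resFactor1_pos q))]
  calc (shintaniAlpha s + shintaniBeta) * resFactor1 q
      ≤ (shintaniAlpha s + shintaniBeta) * ((2 : ℝ) ^ q.primeFactors.card * (q : ℝ) ^ (-2 : ℝ)) :=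
        mul_le_mul_of_nonneg_left (resFactor1_le hq) hab.le
    _ ≤ (shintaniAlpha s + shintaniBeta) * (C * (q : ℝ) ^ η * (q : ℝ) ^ (-2 : ℝ)) :=
        mul_le_mul_of_nonneg_left (mul_le_mul_of_nonneg_right (hωC q hq.ne_zero) (Real.rpow_nonneg hq0.le _)) hab.le
    _ = (shintaniAlpha s + shintaniBeta) * C * (q : ℝ) ^ (-2 + η) := by
        rw [mul_assoc C, ← Real.rpow_add hq0, add_comm η]; ring

/-- `(6/5)|γ^s ∏_{p∣q} 𝒞_p| ≤ C_η q^{-5/3+η}` on squarefree `q` ((13) + (15) + (eq:res_p2)). [folklore] -/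
theorem exists_r₂_le (s : ℤ) {η : ℝ} (hη : 0 < η) : ∃ C₂ : ℝ, ∀ q : ℕ, Squarefree q →
    |6 / 5 * (shintaniGamma s * resFactor56 q)| ≤ C₂ * (q : ℝ) ^ (-(5 : ℝ) / 3 + η) := by
  obtain ⟨C, hC, hωC⟩ := pow_card_primeFactors_le (A := 4) (by norm_num) hη
  refine ⟨6 / 5 * |shintaniGamma s| * C, fun q hq => ?_⟩
  have hq0 : (0 : ℝ) < q := by exact_mod_cast Nat.pos_of_ne_zero hq.ne_zero
  rw [abs_mul, abs_mul, abs_of_pos (by norm_num : (0 : ℝ) < 6 / 5)]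
  calc 6 / 5 * (|shintaniGamma s| * |resFactor56 q|)
      ≤ 6 / 5 * (|shintaniGamma s| * ((4 : ℝ) ^ q.primeFactors.card * (q : ℝ) ^ (-(5 : ℝ) / 3))) :=
        mul_le_mul_of_nonneg_left (mul_le_mul_of_nonneg_left (abs_resFactor56_le hq) (abs_nonneg _)) (by norm_num)
    _ ≤ 6 / 5 * (|shintaniGamma s| * (C * (q : ℝ) ^ η * (q : ℝ) ^ (-(5 : ℝ) / 3))) :=
        mul_le_mul_of_nonneg_left (mul_le_mul_of_nonneg_left
          (mul_le_mul_of_nonneg_right (hωC q hq.ne_zero) (Real.rpow_nonneg hq0.le _)) (abs_nonneg _)) (by norm_num)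
    _ = 6 / 5 * |shintaniGamma s| * C * (q : ℝ) ^ (-(5 : ℝ) / 3 + η) := by
        rw [mul_assoc C, ← Real.rpow_add hq0, add_comm η]; ring

/-! ### Proposition 5.1 on `[Q, 2Q)` -/

/-- Proposition 5.1 on the half-open block: `Σ_{q ∈ [Q,2Q) sqfree} δ̂₁(Ψ_{q²}) ≤ C Q^{2+ε}`. [folklore] -/
theorem sum_Ico_dualDensity_le {ε C : ℝ} (h : DualDensityPsiBound ε C) {Q : ℕ} (hQ : 1 ≤ Q) :
    ∑ q ∈ (Finset.Ico Q (2 * Q)).filter Squarefree, dualDensity (psiMod q) ≤ C * (Q : ℝ) ^ (2 + ε) := by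
  refine le_trans (Finset.sum_le_sum_of_subset_of_nonneg ?_ fun q _ _ => dualDensity_nonneg _) (h Q hQ)
  intro q hq
  rw [Finset.mem_filter, Finset.mem_Ico] at hq
  rw [Finset.mem_filter, Finset.mem_Icc]
  exact ⟨⟨hq.1.1, hq.1.2.le⟩, hq.2⟩

/-! ### The `ShintaniFamilyInput` from Theorems 2.4, 3.2 and Proposition 5.1 -/

/-- `Φ_q = Ψ_{q²}` is a nonnegative real function (values `0, 1`), as Theorem 3.1 requires. [folklore] -/
theorem psiMod_nonneg (q : ℕ) (y : BinaryCubic (ZMod (16 * q ^ 2))) : 0 ≤ (psiMod q y).re ∧ (psiMod q y).im = 0 := by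
  rcases psiMod_eq_zero_or_one q y with h | h <;> simp [h]

/-- **`Thm 2.4 ∧ Thm 3.2 ∧ Prop 5.1 ⟹ ShintaniFamilyInput s ((α^s + β)(6/π²)²)`** with the real data
`r₁(q) = Res_{s=1} ξ^s(s, Ψ_{q²}) = (α^s + β)∏_{p∣q}(2p⁻² − p⁻⁴)`, `r₂(q) = (6/5) Res_{s=5/6} ξ^s(s, Ψ_{q²}) = (6/5)γ^s ∏_{p∣q} 𝒞_p`,
`δ̂₁(q) = dualDensity (psiMod q)`. The field `landauAvg` is Theorem 3.2 for the family `{(Ψ_{q²}, X)}_{q ∈ I}`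
(`m_q = 16q²`, `Φ_q ≥ 0` and `GL₂(ℤ/mℤ)`-invariant by `psiMod_twist`, `X_q = X`), its hypothesis (16) being supplied
by `|r₂(q)| ≤ c' X^{1/6} r₁(q)` since `‖Res_{5/6}‖ = (5/6)|r₂(q)| ≤ |r₂(q)|` and `‖Res_1‖ = r₁(q)`; `N^s(X, Ψ_{q²}) = nonFundCount s q X`.
[cite: BhargavaTaniguchiThorne2023, §5 (the E₁/E₂ paragraphs: Thm 3.2 for Ψ_{q²} with (13), (15), (eq:res_p2), (21), Prop. 5.1)] -/
def shintaniFamilyInput_of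
    (h24 : ∀ q : ℕ, Squarefree q → ∀ sgn : ℤ, (sgn = 1 ∨ sgn = -1) → HasPsiResidues q sgn)
    (h32 : ∀ c₁₆ c₁₉ cL cU : ℝ, 0 < c₁₆ → 0 < c₁₉ → 0 < cL → cL ≤ cU → ∃ C : ℝ, LandauAverageBound c₁₆ c₁₉ cL cU C)
    (h51 : ∀ ε : ℝ, 0 < ε → ∃ C : ℝ, DualDensityPsiBound ε C)
    {s : ℤ} (hs : s = 1 ∨ s = -1) : ShintaniFamilyInput s (mainConstant s) where
  r₁ q := (shintaniAlpha s + shintaniBeta) * resFactor1 q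
  r₂ q := 6 / 5 * (shintaniGamma s * resFactor56 q)
  dhat q := dualDensity (psiMod q)
  r₁_lower := ⟨shintaniAlpha s + shintaniBeta, add_pos (shintaniAlpha_pos s) shintaniBeta_pos,
    fun q hq => mul_le_mul_of_nonneg_left (rpow_neg_two_le_resFactor1 hq)
      (add_pos (shintaniAlpha_pos s) shintaniBeta_pos).le⟩
  abs_r₁_le η hη := exists_r₁_le s hη
  hasSum_moebius_mul_r₁ := hasSum_moebius_mul_r₁ s
  abs_r₂_le η hη := exists_r₂_le s hη
  dhat_nonneg q := dualDensity_nonneg _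
  sum_dhat_le η hη := by
    obtain ⟨C, hC⟩ := h51 η hη
    exact ⟨C, fun Q hQ => sum_Ico_dualDensity_le hC hQ⟩
  landauAvg c hc c' hc' := by
    obtain ⟨C, hC⟩ := h32 c' c 1 1 hc' hc one_pos le_rfl
    refine ⟨C, fun X hX I hIsq h16 h19 => ?_⟩
    have hX' : (1 : ℝ) ≤ X := by exact_mod_cast hX
    have hab : 0 < shintaniAlpha s + shintaniBeta := add_pos (shintaniAlpha_pos s) shintaniBeta_pos
    -- the residues of the members of the family
    have hR1 : ∀ q ∈ I, shintaniRes1 (psiMod q) s = (((shintaniAlpha s + shintaniBeta) * resFactor1 q : ℝ) : ℂ) :=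
      fun q hq => (h24 q (hIsq q hq) s hs).shintaniRes1_eq
    have hR56 : ∀ q ∈ I, shintaniRes56 (psiMod q) s = ((shintaniGamma s * resFactor56 q : ℝ) : ℂ) :=
      fun q hq => (h24 q (hIsq q hq) s hs).shintaniRes56_eq
    have hR1re : ∀ q ∈ I, (shintaniRes1 (psiMod q) s).re = (shintaniAlpha s + shintaniBeta) * resFactor1 q :=
      fun q hq => by rw [hR1 q hq, Complex.ofReal_re]
    have hmain := hC s hs ℕ I (fun q => 16 * q ^ 2) (fun q => psiMod q) (fun _ => (X : ℝ)) X hX'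
      (fun q hq => by have := (hIsq q hq).ne_zero; positivity)
      (fun q _ y => psiMod_nonneg q y)
      (fun q _ γ hγ y => psiMod_twist q hγ y)
      (fun q _ => ⟨by rw [one_mul], by rw [one_mul]⟩)
      (fun q hq => by
        -- (16): `‖Res_{5/6}‖ = (5/6)|r₂ q| ≤ |r₂ q| ≤ c' X^{1/6} r₁ q = c' X^{1/6} ‖Res_1‖`
        rw [(h24 q (hIsq q hq) s hs).norm_shintaniRes56, (h24 q (hIsq q hq) s hs).norm_shintaniRes1]
        have h := h16 q hq
        rw [abs_mul, abs_of_pos (by norm_num : (0 : ℝ) < 6 / 5)] at h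
        have hnn : 0 ≤ c' * (X : ℝ) ^ ((1 : ℝ) / 6) * ((shintaniAlpha s + shintaniBeta) * resFactor1 q) :=
          mul_nonneg (mul_nonneg hc'.le (Real.rpow_nonneg (by positivity) _)) (mul_pos hab (resFactor1_pos q)).le
        nlinarith [abs_nonneg (shintaniGamma s * resFactor56 q)])
      (by
        -- (19)
        rw [Finset.sum_congr rfl hR1re]
        exact h19)
    -- translate the conclusion
    rw [Finset.sum_congr rfl hR1re] at hmain
    refine le_of_eq_of_le (Finset.sum_congr rfl fun q hq => ?_) hmain
    rw [shintaniPartialSum_psiMod hs, hR1 q hq, hR56 q hq]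
    have hcast : ((nonFundCount s q X : ℝ) : ℂ)
        - (((shintaniAlpha s + shintaniBeta) * resFactor1 q : ℝ) : ℂ) * ((X : ℝ) : ℂ)
        - 6 / 5 * ((shintaniGamma s * resFactor56 q : ℝ) : ℂ) * ((((X : ℝ) ^ ((5 : ℝ) / 6)) : ℝ) : ℂ)
        = ((nonFundCount s q X - (shintaniAlpha s + shintaniBeta) * resFactor1 q * X
            - 6 / 5 * (shintaniGamma s * resFactor56 q) * (X : ℝ) ^ ((5 : ℝ) / 6) : ℝ) : ℂ) := by
      push_cast; ring
    rw [hcast, Complex.norm_real, Real.norm_eq_abs]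

/-! ### (3) and Theorem 1.2 -/

/-- **BTT (3) = `btt_fundCubicFieldCount_sum` from Theorem 2.4 (`h24`), Theorem 3.2 (`h32`), Proposition 5.1 (`h51`)
— each in its printed form on the real objects (residues of the continuation, the dual density `δ̂₁`) — and
Proposition 4.5 (`btt_uniformity_sqDvd`)**: the complete direct proof of §5 with exactly the source's four
imported theorems as hypotheses. [cite: BhargavaTaniguchiThorne2023, Section 5 (direct proof of (3): (20), (eq:main_term), E₁ + E₂ + E₃ ≪ X^{2/3+ε})] -/
theorem btt_fundCubicFieldCount_sum_of_thm24_thm32_prop51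
    (h24 : ∀ q : ℕ, Squarefree q → ∀ sgn : ℤ, (sgn = 1 ∨ sgn = -1) → HasPsiResidues q sgn)
    (h32 : ∀ c₁₆ c₁₉ cL cU : ℝ, 0 < c₁₆ → 0 < c₁₉ → 0 < cL → cL ≤ cU → ∃ C : ℝ, LandauAverageBound c₁₆ c₁₉ cL cU C)
    (h51 : ∀ ε : ℝ, 0 < ε → ∃ C : ℝ, DualDensityPsiBound ε C)
    (hU : btt_uniformity_sqDvd) : btt_fundCubicFieldCount_sum := by
  have hneg : ShintaniFamilyInput (-1) (3 / Real.pi ^ 2) :=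
    mainConstant_neg_one ▸ shintaniFamilyInput_of h24 h32 h51 (Or.inr rfl)
  have hpos : ShintaniFamilyInput 1 (2 / Real.pi ^ 2) :=
    mainConstant_one ▸ shintaniFamilyInput_of h24 h32 h51 (Or.inl rfl)
  exact btt_fundCubicFieldCount_sum_of_shintaniFamilyInput hneg hpos hU

/-- … and BTT Theorem 1.2 (`btt_threeTorsion_sum`) with, in addition, the class-field-theory dictionary
`#Cl(ℚ(√D))[3] = 2 N₃(D) + 1`. [cite: BhargavaTaniguchiThorne2023, §5 ((3) ⟺ Thm 1.2)] -/
theorem btt_threeTorsion_sum_of_thm24_thm32_prop51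
    (hdict : threeTorsion_eq_two_mul_cubicFieldCountOfDisc_add_one)
    (h24 : ∀ q : ℕ, Squarefree q → ∀ sgn : ℤ, (sgn = 1 ∨ sgn = -1) → HasPsiResidues q sgn)
    (h32 : ∀ c₁₆ c₁₉ cL cU : ℝ, 0 < c₁₆ → 0 < c₁₉ → 0 < cL → cL ≤ cU → ∃ C : ℝ, LandauAverageBound c₁₆ c₁₉ cL cU C)
    (h51 : ∀ ε : ℝ, 0 < ε → ∃ C : ℝ, DualDensityPsiBound ε C)
    (hU : btt_uniformity_sqDvd) : Literature.NumberTheory.QuadraticFields.btt_threeTorsion_sum := by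
  have hneg : ShintaniFamilyInput (-1) (3 / Real.pi ^ 2) :=
    mainConstant_neg_one ▸ shintaniFamilyInput_of h24 h32 h51 (Or.inr rfl)
  have hpos : ShintaniFamilyInput 1 (2 / Real.pi ^ 2) :=
    mainConstant_one ▸ shintaniFamilyInput_of h24 h32 h51 (Or.inl rfl)
  exact btt_threeTorsion_sum_of_shintaniFamilyInput hdict hneg hpos hU

end Literature.NumberTheory.CubicFields

end
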